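import Summits.FinalStateConjecture.FinalStateConjecture.Theses.ExactKerrEnds
import Summits.FinalStateConjecture.FinalStateConjecture.Theorems.PhaseMixingCaptureCaptureSufficesC2SettlingTransport
import Literature.Geometry.Lorentzian.ExactKerrEnd
import HarnessLib

/-!
# Crux `SettlingAlongCensoredKerrEnds` (stmt-FinalStateConjecture-18520) of route `ExactKerrEnds`:
# the crux is IMPLIED BY THE SUMMIT STATEMENT, hence equivalent to it under the route's other items

Write `Settled D` for the conclusion clause of the crux (every maximal vacuum Cauchy development of
`D` has complete `𝓘⁺` and carries a `C²` sub-extremal `N`-Kerr `FinalStateDecomposition` of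
`O = exteriorOf`, with `RaysStayInClosure`, `HasExhaustiveCharts`, `IsFutureOriented`) — the summit's
per-datum property minus its anti-vacuity conjunct `∃ MGHD`.

* `settled_comap_iff`, `settled_breatheFamily`, `settledSelfWitness` — `Settled` is invariant under
  re-indexing the datum by a diffeomorphism (`VacuumCauchyDevelopment.forall_isMaximal_comap_iff` fed
  `cniSettling_precomp_iff`), so the breathing curve of a settled admissible datum
  (`TameBreathingCurve.lean`) is a tame, injective, immersed curve of settled admissible data through
  it (SELF-WITNESS).
* `settlingAlongCensoredKerrEnds_of_settledCurves` — the crux uses its curve `F` only through the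
  base datum `F 0`: it follows from "through every admissible datum passes a tame injective immersed
  admissible curve whose members off `0` are settled".
* `settlingAlongCensoredKerrEnds_of_isTameChristodoulouGeneric` — hence from plain tame genericity of
  `Settled` in the admissible class (exceptional data: the generic escape; settled data: the
  self-witness).
* `settlingAlongCensoredKerrEnds_of_finalStateConjecture` — and from the summit statement
  `FinalStateConjecture` itself (whose property is `(∃ MGHD) ∧ Settled`; self-witness
  `summitSelfWitness` of `…CaptureSufficesC2SettlingTransport.lean`).
* `settlingAlongCensoredKerrEnds_iff_finalStateConjecture` — with the route's deciding theorem
  `closes`: granted `TameEscapeToKerrEnds`, `CensorshipAlongKerrEnds`, `MGHDExists`, the crux is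
  EQUIVALENT to the summit. (The refuter's birth note recorded `S ↛ C₂` as a formal gap — "settled
  curves through already-settled data"; the breathing self-witness closes exactly that gap.)
* `settledCurve_of_settlingAlongCensoredKerrEnds` — conversely the crux, read on constant curves,
  hands a settled tame injective immersed admissible curve through every admissible Kerr-ended
  censored datum.

Consequence for the line: no refutation of the crux exists below a refutation of the (audited)
summit statement, and no proof of it is cheaper than generic settling through every admissible
datum; the Kerr-ended hypothesis on the members of `F` is idle in the crux AS TYPED (only `F 0`,
an arbitrary admissible datum, is constrained by the conclusion).

References: Christodoulou, CQG 16 (1999) A23, p. A24 (genericity in a fixed space of data);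
Choquet-Bruhat–Geroch, CMP 14 (1969), p. 330 (diffeomorphism covariance of developments);
Dafermos–Luk arXiv:1710.01722, Conjecture 1.
-/

set_option linter.dupNamespace false

noncomputable section

open Set Function Filter
open scoped Manifold ContDiff Topology

namespace Summit.FinalStateConjecture.FinalStateConjecture.Theorems.ExactKerrEnds

open Literature.Geometry.Lorentzian
open Summit.FinalStateConjecture (HasCompleteNullInfinity exteriorOf RaysStayInClosure HasExhaustiveCharts
  IsFutureOriented)
open Summit.FinalStateConjecture.FinalStateConjecture.Theses.ExactKerrEnds (SettlingAlongCensoredKerrEnds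
  TameEscapeToKerrEnds CensorshipAlongKerrEnds MGHDExists closes)
open Summit.FinalStateConjecture.FinalStateConjecture.Theorems.PhaseMixingCaptureCaptureSufficesC2
  (cniSettling_precomp_iff summitSelfWitness injective_mfderiv_homeomorph_symm)

/-! ### `Settled` is invariant under re-indexing; self-witnesses -/

section SelfWitness

variable {X : Type} [TopologicalSpace X] [ChartedSpace E3 X] [IsManifold (𝓡 3) ∞ X] [ConnectedSpace X]
  {D : InitialDataSet (𝓡 3) X}

/-- **`Settled (Φ^* D) ↔ Settled D`** for a diffeomorphism `Φ` of `X` (homeomorphism, smooth with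
injective differentials both ways): every maximal development of `Φ^* D` is the re-indexing of one of
`D` along `Φ`, on which complete `𝓘⁺` and the settling clause transfer (`cniSettling_precomp_iff`).
[cite: ChoquetBruhatGeroch1969CMP, p. 330] -/
theorem settled_comap_iff (Φ : X ≃ₜ X) (hΦ : ContMDiff (𝓡 3) (𝓡 3) (∞ + 1) Φ)
    (hΦ' : ∀ u, Injective (mfderiv (𝓡 3) (𝓡 3) Φ u)) (hΨ : ContMDiff (𝓡 3) (𝓡 3) (∞ + 1) Φ.symm)
    (hΨ' : ∀ u, Injective (mfderiv (𝓡 3) (𝓡 3) Φ.symm u)) :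
    (∀ 𝒟' : VacuumCauchyDevelopment (D.comap Φ hΦ hΦ'), 𝒟'.IsMaximal →
        HasCompleteNullInfinity 𝒟'.toCauchyDevelopment ∧
          ∃ (O : Set 𝒟'.carrier) (dd : FinalStateDecomposition 𝒟'.toSpacetime O 2),
            (∀ i, Kerr.IsSubextremal (dd.mass i) (dd.spin i)) ∧
              O = exteriorOf 𝒟'.toCauchyDevelopment dd.charted ∧
                RaysStayInClosure 𝒟'.toCauchyDevelopment O ∧ HasExhaustiveCharts dd ∧
                  IsFutureOriented dd) ↔
      ∀ 𝒟 : VacuumCauchyDevelopment D, 𝒟.IsMaximal →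
        HasCompleteNullInfinity 𝒟.toCauchyDevelopment ∧
          ∃ (O : Set 𝒟.carrier) (dd : FinalStateDecomposition 𝒟.toSpacetime O 2),
            (∀ i, Kerr.IsSubextremal (dd.mass i) (dd.spin i)) ∧
              O = exteriorOf 𝒟.toCauchyDevelopment dd.charted ∧
                RaysStayInClosure 𝒟.toCauchyDevelopment O ∧ HasExhaustiveCharts dd ∧
                  IsFutureOriented dd :=
  VacuumCauchyDevelopment.forall_isMaximal_comap_iff Φ hΦ hΦ' hΨ hΨ'
    (fun {_} 𝒟 ↦ HasCompleteNullInfinity 𝒟.toCauchyDevelopment ∧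
      ∃ (O : Set 𝒟.carrier) (dd : FinalStateDecomposition 𝒟.toSpacetime O 2),
        (∀ i, Kerr.IsSubextremal (dd.mass i) (dd.spin i)) ∧
          O = exteriorOf 𝒟.toCauchyDevelopment dd.charted ∧
            RaysStayInClosure 𝒟.toCauchyDevelopment O ∧ HasExhaustiveCharts dd ∧ IsFutureOriented dd)
    fun 𝒟 Θ hΘ hΘ' ↦ cniSettling_precomp_iff 𝒟 Θ hΘ hΘ'

variable [T2Space X] {e : AFEnd X} {z₀ : E3} {r : ℝ} (B : AFEnd.BreathingData e z₀ r)
  (d : InitialDataSet (𝓡 3) X)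

/-- **`Settled` passes from `d` to every member `(breathe (σ t))^* d` of its breathing family**
(`settled_comap_iff` along the breathing diffeomorphism). [folklore] -/
theorem settled_breatheFamily (t : ℝ)
    (hP : ∀ 𝒟 : VacuumCauchyDevelopment d, 𝒟.IsMaximal →
        HasCompleteNullInfinity 𝒟.toCauchyDevelopment ∧
          ∃ (O : Set 𝒟.carrier) (dd : FinalStateDecomposition 𝒟.toSpacetime O 2),
            (∀ i, Kerr.IsSubextremal (dd.mass i) (dd.spin i)) ∧
              O = exteriorOf 𝒟.toCauchyDevelopment dd.charted ∧
                RaysStayInClosure 𝒟.toCauchyDevelopment O ∧ HasExhaustiveCharts dd ∧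
                  IsFutureOriented dd) :
    ∀ 𝒟 : VacuumCauchyDevelopment (AFEnd.breatheFamily B d t), 𝒟.IsMaximal →
        HasCompleteNullInfinity 𝒟.toCauchyDevelopment ∧
          ∃ (O : Set 𝒟.carrier) (dd : FinalStateDecomposition 𝒟.toSpacetime O 2),
            (∀ i, Kerr.IsSubextremal (dd.mass i) (dd.spin i)) ∧
              O = exteriorOf 𝒟.toCauchyDevelopment dd.charted ∧
                RaysStayInClosure 𝒟.toCauchyDevelopment O ∧ HasExhaustiveCharts dd ∧
                  IsFutureOriented dd := by
  set Φ : X ≃ₜ X := AFEnd.breatheHomeomorph B (AFEnd.abs_squash_lt_invScale B t) with hΦdef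
  have hΦ : ContMDiff (𝓡 3) (𝓡 3) (∞ + 1) Φ :=
    AFEnd.contMDiff_breathe_succ B (AFEnd.abs_squash_lt_scale B t).2
  have hΦ' : ∀ u, Injective (mfderiv (𝓡 3) (𝓡 3) Φ u) :=
    (AFEnd.breatheScale_spec B).2.2 _ (AFEnd.abs_squash_lt_scale B t).1
  have hΨ : ContMDiff (𝓡 3) (𝓡 3) (∞ + 1) Φ.symm := AFEnd.contMDiff_unbreathe B _
  have hΨ' : ∀ u, Injective (mfderiv (𝓡 3) (𝓡 3) Φ.symm u) :=
    injective_mfderiv_homeomorph_symm Φ hΦ hΨ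
  have key : AFEnd.breatheFamily B d t = d.comap Φ hΦ hΦ' := rfl
  rw [key]
  exact (settled_comap_iff Φ hΦ hΦ' hΨ hΨ').2 hP

/-- **SELF-WITNESSES OF `Settled`.** Through every admissible datum `d` all of whose maximal vacuum
Cauchy developments have complete `𝓘⁺` and settle down (sub-extremal holes, `O = exteriorOf`,
`RaysStayInClosure`, exhaustive future-oriented charts) passes a tame (on a collared restriction of
the sole end of `d`), injective, immersed curve of admissible data all of whose members are settled:
the breathing curve of `d`. [cite: Christodoulou1999, p. A24] -/
theorem settledSelfWitness :
    ∀ (X : Type) [TopologicalSpace X] [ChartedSpace E3 X] [IsManifold (𝓡 3) ∞ X] [T2Space X]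
      [SecondCountableTopology X] [ConnectedSpace X] (e : AFEnd X) (d : InitialDataSet (𝓡 3) X),
      InitialDataSet.IsTameDataFamily e 1 (fun _ : EuclideanSpace ℝ (Fin 1) ↦ d) →
        d ∈ admissibleVacuumData X →
          (∀ 𝒟 : VacuumCauchyDevelopment d, 𝒟.IsMaximal →
              Summit.FinalStateConjecture.HasCompleteNullInfinity 𝒟.toCauchyDevelopment ∧
                ∃ (O : Set 𝒟.carrier) (dd : FinalStateDecomposition 𝒟.toSpacetime O 2),
                  (∀ i, Kerr.IsSubextremal (dd.mass i) (dd.spin i)) ∧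
                    O = Summit.FinalStateConjecture.exteriorOf 𝒟.toCauchyDevelopment dd.charted ∧
                      Summit.FinalStateConjecture.RaysStayInClosure 𝒟.toCauchyDevelopment O ∧
                        Summit.FinalStateConjecture.HasExhaustiveCharts dd ∧
                        Summit.FinalStateConjecture.IsFutureOriented dd) →
          ∃ (e' : AFEnd X) (F' : EuclideanSpace ℝ (Fin 1) → InitialDataSet (𝓡 3) X),
            InitialDataSet.IsTameDataFamily e' 1 F' ∧ F' 0 = d ∧ Function.Injective F' ∧
              InitialDataSet.IsImmersedAtZero 1 F' ∧ (∀ c, F' c ∈ admissibleVacuumData X) ∧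
              ∀ c : EuclideanSpace ℝ (Fin 1), c ≠ 0 →
                ∀ 𝒟 : VacuumCauchyDevelopment (F' c), 𝒟.IsMaximal →
                    Summit.FinalStateConjecture.HasCompleteNullInfinity 𝒟.toCauchyDevelopment ∧
                      ∃ (O : Set 𝒟.carrier) (dd : FinalStateDecomposition 𝒟.toSpacetime O 2),
                        (∀ i, Kerr.IsSubextremal (dd.mass i) (dd.spin i)) ∧
                          O = Summit.FinalStateConjecture.exteriorOf 𝒟.toCauchyDevelopment dd.charted ∧
                            Summit.FinalStateConjecture.RaysStayInClosure 𝒟.toCauchyDevelopment O ∧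
                              Summit.FinalStateConjecture.HasExhaustiveCharts dd ∧
                              Summit.FinalStateConjecture.IsFutureOriented dd := by
  intro X _ _ _ _ _ _ e d _ hd hP
  obtain ⟨-, e₀, M, hsole, hdecay⟩ := id hd
  set z₀ : E3 := (e₀.R + 3) • EuclideanSpace.single (0 : Fin 3) (1 : ℝ) with hz₀
  have hz₀n : ‖z₀‖ = e₀.R + 3 := by
    rw [hz₀, norm_smul, PiLp.norm_single, norm_one, mul_one,
      Real.norm_of_nonneg (by linarith [e₀.R_pos])]
  have B : e₀.BreathingData z₀ 1 := ⟨one_pos, by rw [hz₀n]; linarith⟩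
  have hR₁ : e₀.R < e₀.R + 1 := by linarith
  exact ⟨e₀.restrict hR₁.le, fun c ↦ AFEnd.breatheFamily B d (c 0),
    AFEnd.isTameDataFamily_restrict_breatheCurve B d hsole hdecay hR₁,
    AFEnd.breatheCurve_zero B d, AFEnd.injective_breatheCurve B d,
    AFEnd.isImmersedAtZero_breatheCurve B d,
    fun c ↦ AFEnd.breatheCurve_mem_admissibleVacuumData B d hd c,
    fun c _ ↦ settled_breatheFamily B d (c 0) hP⟩

end SelfWitness

/-! ### The crux from settled curves through every admissible datum -/

/-- **The crux uses its curve only through the base datum.** If through every admissible datum `d`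
(handed over with ONE tame constant curve, i.e. a sole DR-flat end) passes a tame, injective,
immersed curve of admissible data with `F' 0 = d` whose members off `0` are settled, then
`SettlingAlongCensoredKerrEnds` holds: apply it to `d = F 0` (the dichotomy, the Kerr-endedness and
the censorship of the members of `F` are not used). [cite: Christodoulou1999, p. A24] -/
theorem settlingAlongCensoredKerrEnds_of_settledCurves
    (h : ∀ (X : Type) [TopologicalSpace X] [ChartedSpace E3 X] [IsManifold (𝓡 3) ∞ X] [T2Space X]
      [SecondCountableTopology X] [ConnectedSpace X] (e : AFEnd X) (d : InitialDataSet (𝓡 3) X),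
      InitialDataSet.IsTameDataFamily e 1 (fun _ : EuclideanSpace ℝ (Fin 1) ↦ d) →
        d ∈ admissibleVacuumData X →
          ∃ (e' : AFEnd X) (F' : EuclideanSpace ℝ (Fin 1) → InitialDataSet (𝓡 3) X),
            InitialDataSet.IsTameDataFamily e' 1 F' ∧ F' 0 = d ∧ Function.Injective F' ∧
              InitialDataSet.IsImmersedAtZero 1 F' ∧ (∀ c, F' c ∈ admissibleVacuumData X) ∧
              ∀ c : EuclideanSpace ℝ (Fin 1), c ≠ 0 →
                ∀ 𝒟 : VacuumCauchyDevelopment (F' c), 𝒟.IsMaximal →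
                    HasCompleteNullInfinity 𝒟.toCauchyDevelopment ∧
                      ∃ (O : Set 𝒟.carrier) (dd : FinalStateDecomposition 𝒟.toSpacetime O 2),
                        (∀ i, Kerr.IsSubextremal (dd.mass i) (dd.spin i)) ∧
                          O = exteriorOf 𝒟.toCauchyDevelopment dd.charted ∧
                            RaysStayInClosure 𝒟.toCauchyDevelopment O ∧ HasExhaustiveCharts dd ∧
                              IsFutureOriented dd) :
    SettlingAlongCensoredKerrEnds := by
  intro X _ _ _ _ _ _ _ _ _ e F hF _ h𝓓 _
  obtain ⟨_, hsole, ⟨M, _, hSAF⟩, _⟩ := hF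
  exact h X e (F 0) (InitialDataSet.isTameDataFamily_const hsole 1 (hSAF 0)) (h𝓓 0)

/-- **The crux from tame genericity of `Settled`.** If in every admissible class the property
`Settled` (complete `𝓘⁺` and settling of every maximal development) is tame-Christodoulou-generic
with codimension `≥ 1`, then `SettlingAlongCensoredKerrEnds` holds: through an exceptional base datum
the generic escape, through a settled one the breathing self-witness (`settledSelfWitness`).
[cite: Christodoulou1999, p. A24] -/
theorem settlingAlongCensoredKerrEnds_of_isTameChristodoulouGeneric
    (h : ∀ (X : Type) [TopologicalSpace X] [ChartedSpace E3 X] [IsManifold (𝓡 3) ∞ X] [T2Space X]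
      [SecondCountableTopology X] [ConnectedSpace X],
      InitialDataSet.IsTameChristodoulouGeneric (admissibleVacuumData X)
        (fun D ↦ ∀ 𝒟 : VacuumCauchyDevelopment D, 𝒟.IsMaximal →
          HasCompleteNullInfinity 𝒟.toCauchyDevelopment ∧
            ∃ (O : Set 𝒟.carrier) (dd : FinalStateDecomposition 𝒟.toSpacetime O 2),
              (∀ i, Kerr.IsSubextremal (dd.mass i) (dd.spin i)) ∧
                O = exteriorOf 𝒟.toCauchyDevelopment dd.charted ∧
                  RaysStayInClosure 𝒟.toCauchyDevelopment O ∧ HasExhaustiveCharts dd ∧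
                    IsFutureOriented dd) 1) :
    SettlingAlongCensoredKerrEnds := by
  refine settlingAlongCensoredKerrEnds_of_settledCurves fun X _ _ _ _ _ _ e d hconst hd ↦ ?_
  by_cases hP : ∀ 𝒟 : VacuumCauchyDevelopment d, 𝒟.IsMaximal →
      HasCompleteNullInfinity 𝒟.toCauchyDevelopment ∧
        ∃ (O : Set 𝒟.carrier) (dd : FinalStateDecomposition 𝒟.toSpacetime O 2),
          (∀ i, Kerr.IsSubextremal (dd.mass i) (dd.spin i)) ∧
            O = exteriorOf 𝒟.toCauchyDevelopment dd.charted ∧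
              RaysStayInClosure 𝒟.toCauchyDevelopment O ∧ HasExhaustiveCharts dd ∧
                IsFutureOriented dd
  · exact settledSelfWitness X e d hconst hd hP
  · obtain ⟨e', F', hF', himm, h0, hinj, h𝓓', hgood⟩ := h X d ⟨hd, hP⟩
    exact ⟨e', F', hF', h0, hinj, himm, h𝓓', fun c hc ↦
      by_contra fun hneg ↦ hgood c hc ⟨h𝓓' c, hneg⟩⟩

/-! ### The crux from — and, under the route's other items, equivalent to — the summit -/

/-- **THE SUMMIT IMPLIES THE CRUX.** `FinalStateConjecture → SettlingAlongCensoredKerrEnds`: the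
summit's tame-generic property is `(∃ MGHD) ∧ Settled`; through an exceptional base datum `F 0` the
summit hands a tame injective immersed admissible curve with good — in particular settled — members
off `0`, and through a good one the breathing curve is such a curve (`summitSelfWitness`). The
Kerr-ended / censored hypotheses of the crux are not used. [cite: DafermosLuk2017, Conjecture 1] -/
theorem settlingAlongCensoredKerrEnds_of_finalStateConjecture (hS : FinalStateConjecture) :
    SettlingAlongCensoredKerrEnds := by
  refine settlingAlongCensoredKerrEnds_of_settledCurves fun X _ _ _ _ _ _ e d hconst hd ↦ ?_
  by_cases hP : (∃ 𝒟 : VacuumCauchyDevelopment d, 𝒟.IsMaximal) ∧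
      ∀ 𝒟 : VacuumCauchyDevelopment d, 𝒟.IsMaximal →
        HasCompleteNullInfinity 𝒟.toCauchyDevelopment ∧
          ∃ (O : Set 𝒟.carrier) (dd : FinalStateDecomposition 𝒟.toSpacetime O 2),
            (∀ i, Kerr.IsSubextremal (dd.mass i) (dd.spin i)) ∧
              O = exteriorOf 𝒟.toCauchyDevelopment dd.charted ∧
                RaysStayInClosure 𝒟.toCauchyDevelopment O ∧ HasExhaustiveCharts dd ∧
                  IsFutureOriented dd
  · obtain ⟨e', F', hF', h0, hinj, himm, h𝓓', hgood⟩ := summitSelfWitness X e d hconst hd hP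
    exact ⟨e', F', hF', h0, hinj, himm, h𝓓', fun c hc ↦ (hgood c hc).2⟩
  · obtain ⟨e', F', hF', himm, h0, hinj, h𝓓', hgood⟩ := hS X d ⟨hd, hP⟩
    exact ⟨e', F', hF', h0, hinj, himm, h𝓓', fun c hc ↦
      by_contra fun hneg ↦ hgood c hc ⟨h𝓓' c, fun hPc ↦ hneg hPc.2⟩⟩

/-- **E-LEVEL ASSEMBLY** (the route's deciding theorem of revs 1–4, re-proved here because route
rev 5 re-typed `closes` over the glue `TameEscapeGivenMassTheorems` and the two promoted mass
theorems, deriving `TameEscapeToKerrEnds` on its first line): `TameEscapeToKerrEnds`,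
`CensorshipAlongKerrEnds`, `SettlingAlongCensoredKerrEnds` and `MGHDExists` imply
`FinalStateConjecture` — every admissible datum has a sole DR-flat end (so constant curves are
tame); composing tame genericities along curves
(`InitialDataSet.isTameChristodoulouGeneric_of_relative'`) once with `Q = KerrEnded`,
`P = KerrEnded ∧ Censored` and once with `Q = KerrEnded ∧ Censored`, `P = Settled`; then
monotonicity of tame genericity re-inserts the anti-vacuity conjunct `∃ MGHD` pointwise.
[cite: Christodoulou1999, p. A24] -/
theorem finalStateConjecture_of_tameEscape :
    TameEscapeToKerrEnds → CensorshipAlongKerrEnds → SettlingAlongCensoredKerrEnds → MGHDExists →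
      FinalStateConjecture := by
  intro hE hC hS hM X _ _ _ _ _ _
  -- every admissible datum has a sole, strongly asymptotically flat end (so constant curves are tame)
  have h𝓓 : ∀ d ∈ admissibleVacuumData X,
      ∃ e : AFEnd X, e.IsSoleEnd ∧ ∃ M : ℝ, e.IsStronglyAsymptoticallyFlatDR d M := by
    intro d hd
    obtain ⟨e, M, hs, hM⟩ := hd.2
    exact ⟨e, hs, M, hM⟩
  -- step 1: "Kerr-ended AND censored" is tame-generic (hE composed with hC along curves)
  have h1 : InitialDataSet.IsTameChristodoulouGeneric (admissibleVacuumData X)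
      (fun D ↦ (fun D ↦ ∀ [Kerr.Facts], ∃ (K : Set X) (U : TopologicalSpace.Opens E3) (M a r₀ : ℝ)
        (hM : 0 ≤ M) (φ : U → X) (ψ : U → Kerr.region a r₀) (ν : NormalField 𝓘(ℝ, E4) ψ),
        IsCompact K ∧ Kᶜ ⊆ range φ ∧ Topology.IsOpenEmbedding φ ∧
          ContMDiff 𝓘(ℝ, E3) (𝓡 3) ((⊤ : ℕ∞) : WithTop ℕ∞) φ ∧ Injective ψ ∧
          (Kerr.smoothMetric M a r₀).IsSpacelikeImmersion 𝓘(ℝ, E3) ψ ∧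
          (Kerr.smoothMetric M a r₀).IsFutureUnitNormal 𝓘(ℝ, E3)
            ((Kerr.timeOrientation M a r₀ hM).ofLE le_top) ψ ν ∧
          (∀ (y : U) (v w : E3), φ y ∉ K → D.h.inner (φ y) (mfderiv 𝓘(ℝ, E3) (𝓡 3) φ y v)
            (mfderiv 𝓘(ℝ, E3) (𝓡 3) φ y w) = Kerr.bilin M a (ψ y : E4)
              (mfderiv 𝓘(ℝ, E3) 𝓘(ℝ, E4) ψ y v) (mfderiv 𝓘(ℝ, E3) 𝓘(ℝ, E4) ψ y w)) ∧
          (∀ [(Kerr.smoothMetric M a r₀).HasLeviCivita] (y : U) (v w : E3), φ y ∉ K →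
            D.k (φ y) (mfderiv 𝓘(ℝ, E3) (𝓡 3) φ y v) (mfderiv 𝓘(ℝ, E3) (𝓡 3) φ y w) =
              (Kerr.smoothMetric M a r₀).secondFundamentalForm 𝓘(ℝ, E3) ψ ν y v w)) D ∧
        (fun D ↦ ∀ 𝒟 : VacuumCauchyDevelopment D, 𝒟.IsMaximal →
          HasCompleteNullInfinity 𝒟.toCauchyDevelopment) D) 1 :=
    InitialDataSet.isTameChristodoulouGeneric_of_relative' h𝓓 (hE X) (hC X)
  -- step 2: complete 𝓘⁺ and settling of EVERY maximal development are produced along censored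
  -- Kerr-ended curves (hS); composition along curves again
  have h2 : InitialDataSet.IsTameChristodoulouGeneric (admissibleVacuumData X)
      (fun D ↦ ∀ 𝒟 : VacuumCauchyDevelopment D, 𝒟.IsMaximal →
        HasCompleteNullInfinity 𝒟.toCauchyDevelopment ∧
          ∃ (O : Set 𝒟.carrier) (d : FinalStateDecomposition 𝒟.toSpacetime O 2),
            (∀ i, Kerr.IsSubextremal (d.mass i) (d.spin i)) ∧
              O = exteriorOf 𝒟.toCauchyDevelopment d.charted ∧
                RaysStayInClosure 𝒟.toCauchyDevelopment O ∧ HasExhaustiveCharts d ∧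
                  IsFutureOriented d) 1 :=
    InitialDataSet.isTameChristodoulouGeneric_of_relative' h𝓓 h1 (hS X)
  -- step 3: the anti-vacuity conjunct (an MGHD exists) holds pointwise on the admissible class
  exact h2.mono fun D hD hsettled ↦ ⟨hM X D hD, hsettled⟩

/-- **Under the route's other three items the crux IS the summit**: granted `TameEscapeToKerrEnds`,
`CensorshipAlongKerrEnds` and `MGHDExists`, `SettlingAlongCensoredKerrEnds ↔ FinalStateConjecture`
(`→` is the route's deciding theorem `closes`; `←` is
`settlingAlongCensoredKerrEnds_of_finalStateConjecture`, which needs none of the three).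
[cite: DafermosLuk2017, Conjecture 1] -/
theorem settlingAlongCensoredKerrEnds_iff_finalStateConjecture (hE : TameEscapeToKerrEnds)
    (hC : CensorshipAlongKerrEnds) (hM : MGHDExists) :
    SettlingAlongCensoredKerrEnds ↔ FinalStateConjecture :=
  ⟨fun hS ↦ finalStateConjecture_of_tameEscape hE hC hS hM,
    settlingAlongCensoredKerrEnds_of_finalStateConjecture⟩

/-- **The same equivalence over the binders of the route's deciding theorem `closes` since rev 5**:
granted the glue `TameEscapeGivenMassTheorems`, the promoted mass theorems `AdmissibleMassNonneg`
and `ZeroMassAdmissibleMinkowskian`, `CensorshipAlongKerrEnds` and `MGHDExists`,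
`SettlingAlongCensoredKerrEnds ↔ FinalStateConjecture` (`→` is `closes` verbatim, `←` is
`settlingAlongCensoredKerrEnds_of_finalStateConjecture`). [cite: DafermosLuk2017, Conjecture 1] -/
theorem settlingAlongCensoredKerrEnds_iff_finalStateConjecture_of_massTheorems
    (hG : Summit.FinalStateConjecture.FinalStateConjecture.Theses.ExactKerrEnds.TameEscapeGivenMassTheorems)
    (hP : Summit.FinalStateConjecture.FinalStateConjecture.Theses.ExactKerrEnds.AdmissibleMassNonneg)
    (hZ : Summit.FinalStateConjecture.FinalStateConjecture.Theses.ExactKerrEnds.ZeroMassAdmissibleMinkowskian)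
    (hC : CensorshipAlongKerrEnds) (hM : MGHDExists) :
    SettlingAlongCensoredKerrEnds ↔ FinalStateConjecture :=
  ⟨fun hS ↦ closes hG hP hZ hC hS hM, settlingAlongCensoredKerrEnds_of_finalStateConjecture⟩

/-- **A refutation of the crux refutes the summit** (contrapositive of
`settlingAlongCensoredKerrEnds_of_finalStateConjecture`): there is no counterexample to the crux
below a counterexample to the audited summit statement. [cite: DafermosLuk2017, Conjecture 1] -/
theorem not_finalStateConjecture_of_not_settlingAlongCensoredKerrEnds
    (h : ¬ SettlingAlongCensoredKerrEnds) : ¬ FinalStateConjecture :=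
  fun hS ↦ h (settlingAlongCensoredKerrEnds_of_finalStateConjecture hS)

/-! ### The constant case read back: settled curves through Kerr-ended censored data -/

/-- **The crux on constant curves.** `SettlingAlongCensoredKerrEnds` hands, through every admissible
datum `d` with a sole DR-flat end (one tame constant curve) which is Kerr-ended
(`InitialDataSet.HasExactKerrEnd`, definitionally the crux's legend) and censored (every maximal
vacuum Cauchy development has complete `𝓘⁺`), a tame, injective, immersed curve of admissible data
with `F' 0 = d` whose members off `0` are settled. [cite: CorvinoSchoen2006, §1 and Thm. 4] -/
theorem settledCurve_of_settlingAlongCensoredKerrEnds (h : SettlingAlongCensoredKerrEnds)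
    (X : Type) [TopologicalSpace X] [ChartedSpace E3 X] [IsManifold (𝓡 3) ∞ X] [T2Space X]
    [SecondCountableTopology X] [ConnectedSpace X] (e : AFEnd X) (d : InitialDataSet (𝓡 3) X)
    (hconst : InitialDataSet.IsTameDataFamily e 1 (fun _ : EuclideanSpace ℝ (Fin 1) ↦ d))
    (hd : d ∈ admissibleVacuumData X) (hKE : d.HasExactKerrEnd)
    (hCen : ∀ 𝒟 : VacuumCauchyDevelopment d, 𝒟.IsMaximal →
      HasCompleteNullInfinity 𝒟.toCauchyDevelopment) :
    ∃ (e' : AFEnd X) (F' : EuclideanSpace ℝ (Fin 1) → InitialDataSet (𝓡 3) X),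
      InitialDataSet.IsTameDataFamily e' 1 F' ∧ F' 0 = d ∧ Function.Injective F' ∧
        InitialDataSet.IsImmersedAtZero 1 F' ∧ (∀ c, F' c ∈ admissibleVacuumData X) ∧
        ∀ c : EuclideanSpace ℝ (Fin 1), c ≠ 0 →
          ∀ 𝒟 : VacuumCauchyDevelopment (F' c), 𝒟.IsMaximal →
              HasCompleteNullInfinity 𝒟.toCauchyDevelopment ∧
                ∃ (O : Set 𝒟.carrier) (dd : FinalStateDecomposition 𝒟.toSpacetime O 2),
                  (∀ i, Kerr.IsSubextremal (dd.mass i) (dd.spin i)) ∧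
                    O = exteriorOf 𝒟.toCauchyDevelopment dd.charted ∧
                      RaysStayInClosure 𝒟.toCauchyDevelopment O ∧ HasExhaustiveCharts dd ∧
                        IsFutureOriented dd :=
  h X e (fun _ ↦ d) hconst (Or.inr fun _ ↦ rfl) (fun _ ↦ hd) fun _ _ ↦ ⟨hKE, hCen⟩

end Summit.FinalStateConjecture.FinalStateConjecture.Theorems.ExactKerrEnds

end
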